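import Literature.NumberTheory.EllipticCurves.BurungaleSkinnerTianWan2024.IntroductionTheoremsOPEN
import Literature.NumberTheory.EllipticCurves.ZpCorankQuasiIso
import Literature.NumberTheory.EllipticCurves.BSDSelmerProofs
import HarnessLib

/-!
# Burungale–Skinner–Tian–Wan (arXiv:2409.01350v2, PREPRINT), Part II (§10–§12) for elliptic curves:
# Thm. 10.12 (full BSD for rank-zero quadratic twists of a semistable curve), Thm. 11.12 (the `p`-part
# of BSD in analytic rank one — ordinary, supersingular and CM clauses), Thm. 12.3 (`p`-converse I:
# corank one with finite `Ш[p^∞]`), Cor. 12.5 (rank `r ≤ 1` and finite `Ш` ⟹ analytic rank `r`) —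
# typed as explicitly labelled OPEN hypotheses (claim-tagged `def … : Prop`, nothing asserted)

LITERATURE-TYPING LAYER (cell `bsd-littype`, seat `bsd-littype-01`; D-0088(4)); companion of
`IntroductionTheoremsOPEN.lean` (same honest framing: UNREFEREED PREPRINT, arXiv v2 of 2024-09-11, no
journal reference on 2026-08-26; every statement is ONE `def … : Prop` carrying
`[claim: BurungaleSkinnerTianWan2024, status: under-review]`, to be taken as an explicit hypothesis and
NEVER fed as a theorem; typed ≠ proved ≠ endorsed). Part II of the paper is written for an elliptic
NEWFORM `g ∈ S₂(Γ₀(N))` with Hecke field `F` and a `GL₂`-type abelian variety `A_g`; this file types the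
ELLIPTIC-CURVE instances only (`F = ℚ`, `d = [F:ℚ] = 1`, `A_g = E`, `λ = p`, `𝒪_λ = ℤ_p`), the case the
BSD ladder consumes. -- TODO(general form): the `GL₂`-type statements (rank `= r·[F:ℚ]`, `λ`-parts,
`L^{(rd)}(1, A_g)/d!`) once the tree has `A_g` vocabulary.

WHAT THE TREE ALREADY HAS from Part II (not restated): Thm. 10.1 = the body form of Thm. 1.3
(Summits-side `…Supersingular.BurungaleSkinnerTianWan2024_thm13_OPEN`; the body form's twist clause is
printed WITHOUT the intro's proviso "divisible only by primes of ordinary reduction" — the tree types the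
intro's narrower clause, the safe reading; recorded as an open question in the cell's
OPEN-QUESTIONS-01.md); Cor. 10.2 for `E` = Thm. 1.5 (`thm15_pPart_OPEN`, `thm15_twist_pPart_OPEN`, same
remark on the twist clause); §12.2–12.3 (Prop. 12.10, Thm. 12.9, Thm. 12.11 = Thm. 1.10) in
`BSDSelmer.lean` / `BSDSelmerPConverse*.lean`. NOT TYPED (no vocabulary in the tree, see the sibling's
docstring): §9's main conjectures 9.3–9.15 and the results 9.18–9.26, Thm. 10.4/10.5/10.8/10.10 (signed /
Greenberg / two-variable main conjectures over `ℚ` and over an imaginary quadratic `L`), Thm. 11.8(b)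
(the Heegner-index bound over `L`), Prop. 11.11 / 12.1 / 12.7 (Kato's main conjecture as a hypothesis).
Thm. 11.6 ("`ord = 1 ⟹ rank A_g(ℚ) = [F:ℚ]`", a new PROOF of Gross–Zagier–Kolyvagin) and Cor. 11.10 are,
for `E`, contained in the tree's published fact `rank_eq_analyticRank_of_analyticRank_le_one` and are not
re-typed as claims.

Source and locators: arXiv v2 TeX e-print (`run/shared/lean/pub/bsd-eis/audit-1-g4/bstw-arxiv-2409.01350v2.tex`,
sha16 `5926f035551c636d`; Part II opens with `\setcounter{section}{8}`, so its sections print as §9–§12)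
and the PDF text `run/shared/lean/pub/bsd-litref/bstw24/staging/bsd-litref-bstw24-ty/text/bstw24-v2-pages.json`
(page hits below are from it): Thm. 10.12 = `\label{theoretic}` tex l.7535, PDF p. 89 (Rem. 10.13 and
Example 1 = `\label{exam}`, p. 90); Thm. 11.12 = `\label{p-BSD}` l.8031, p. 94; Thm. 12.3 =
`\label{p-converse}` l.8146, p. 96; Cor. 12.5 = `\label{pcv-w}` l.8189, p. 96
[corpus: paper:arxiv-2409.01350 p0077 (Thm. "2.12" = 10.12), p0081–p0082 (§"3.3" = 11.3), p0082–p0083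
(§"4.1" = 12.1): the held extraction numbers Part II sections as 1–4]. Verbatim:

> **Theorem 10.12.** Let `E` be a semistable elliptic curve defined over `ℚ` with conductor `N`, and
> `M > 1` a square-free integer with `(M,N) = 1`. Let `E^{(M)}` denote the quadratic twist of `E` by the
> character associated to the quadratic extension `ℚ(√M)/ℚ`. Suppose that the following conditions
> hold. (i) We have `L(1, E^{(M)}) ≠ 0`, (ii) The `2`-part of the BSD formula holds for `E^{(M)}`,
> (iii) `a_3(E) = 0`, (iv) For all odd primes `p`, `E[p]` is an absolutely irreducible
> `G_ℚ`-representation, (v) For any prime `p ∣ N`, there exists a multiplicative prime `q ≠ p` at which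
> `E[p]` is ramified, (vi) `E` has ordinary reduction at prime divisors of `M`. Then the Birch and
> Swinnerton-Dyer conj. is true for `E^{(M)}`, that is, `E^{(M)}(ℚ)` and `Ш(E^{(M)})` are finite, and
> `L(1,E^{(M)})/Ω_{E^{(M)}} = #Ш(E^{(M)}) · ∏_{ℓ∤∞} c_ℓ(E^{(M)}) / #E^{(M)}(ℚ)²_tor`.
> [Proof: GZK for finiteness; Kohnen–Zagier for the sign; (ii); odd `p` good ordinary / multiplicative /
> supersingular by [SU, Thm. 2], [Sk0, Thm. C], Corollary 10.2; odd `p ∣ M` by Theorem 9.21(c).]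
> **Theorem 11.12.** Let `g ∈ S₂(Γ₀(N))` be an elliptic newform, `F` the Hecke field with degree `d` and
> `𝒪` the integer ring. Let `A_g` be an associated `GL₂`-type abelian variety over `ℚ` with
> `𝒪 ↪ End(A_g)`. Let `p ∤ 2N` be a prime, `λ` a prime of `F` above `p` and `T` the `λ`-adic Tate
> module of `A_g`. Suppose that • Either `λ ∤ a_p(g)` or `a_p(g) = 0`, • If `λ ∤ a_p(g)`, then the
> `λ`-adic Galois representation `ρ : G_ℚ → Aut_{𝒪_λ} T` satisfies (irr_ℚ) and (ram). If `a_p(g) = 0`,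
> then `N` is square-free. If `ord_{s=1} L(s,g) = 1`, then the `λ`-part of the Birch and Swinnerton-Dyer
> conj. for `A_g` holds, that is, `rank_ℤ A_g(ℚ) = d`, `Ш(A_g)[λ^∞]` is finite and
> `|L^{(d)}(1,A_g)/(d!·Ω_{A_g} R(A_g))|_λ^{-1} = |#Ш(A_g)[λ^∞] · ∏_{ℓ∣N} c_ℓ(A_g)|_λ^{-1}`. In the CM case
> the same holds for any ordinary or a supersingular prime `p ∤ 2N`.
> **Theorem 12.3.** [same `g`, `A_g`, `p ∤ 2N`, `λ`, `T`] Suppose the following: • Either `a_p(g) = 0`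
> and `N` is square-free or `λ ∤ a_p(g)`, • `ρ : G_ℚ → Aut_{𝒪_λ} T` satisfies (irr_ℚ) if `g` is non-CM,
> and (ram) holds if `p = 3`. Then `corank_{𝒪_λ} Sel_{λ^∞}(A_g) = 1, #Ш(A_g)[λ^∞] < ∞ ⟹
> ord_{s=1} L(s, A_g) = [F:ℚ]`.
> **Corollary 12.5.** Let `g ∈ S₂(Γ₀(N))` be an elliptic newform and `F` the Hecke field. Let `A_g` be
> an associated `GL₂`-type abelian variety. For `r ∈ {0,1}`, `rank_ℤ A_g(ℚ) = r[F:ℚ], #Ш(A_g) < ∞ ⟹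
> ord_{s=1} L(s,A_g) = r[F:ℚ]`. [Proof: "In light of [Ru1, BuTi] it suffices to consider the non-CM
> case … pick an ordinary prime `p ∤ 2N` so that `ρ` satisfies (irr_ℚ) … the `r = 1` case follows from
> Theorem 12.3, and the `r = 0` case from Theorem 9.21(c)." Remark 12.6: "the above result is also
> independently obtained by Kim [Ki1]."]

Transcription (tree dictionary; see the sibling file): (irr_ℚ) = `Irr W p`; (ram) = `Ram W p`;
"supersingular" in this paper MEANS `a_p = 0` (§2.2.11, footnote: "need not imply `a_g(p) = 0` (but only
when `p = 3`). However, we adopt the terminology"); "`N` square-free" = `Semistable W`; "`p ∤ 2N`" =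
`p ≠ 2 ∧ W.HasGoodReductionAtPrime p`; `corank_{ℤ_p} Sel_{p^∞}(E/ℚ) = W.selmerCorank p`;
`Ш(E)[p^∞] = AddCommGroup.primaryComponent W.sha p`; `#Ш < ∞` = `W.ShaFinite`; `rank_ℤ E(ℚ) =
W.mordellWeilRank`; `ord_{s=1} L(E,s) = W.analyticRank`; the `p`-part display in analytic rank `1` =
the no-torsion print shape (`∃ q : ℚ, L'(E,1)/(Ω·Reg) = q ∧ ord_p q = ord_p #Ш + ord_p ∏ c_ℓ`, with
`#Ш = W.shaOrder`, finite here by Gross–Zagier–Kolyvagin, so `ord_p #Ш = ord_p #Ш[p^∞]`); "(ii) the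
`2`-part of the BSD formula holds for `E^{(M)}`" = Miller's `BSDp W 2` for the minimal model `W` of
`E^{(M)}` (in analytic rank `0`: `ord_2 #Ш_an = ord_2 #Ш[2^∞]`); "BSD is true for `E^{(M)}`" =
`W.BSDTriple` (as for Thm. 1.7 in the sibling).
-/

set_option autoImplicit false

noncomputable section

open scoped Classical

open WeierstrassCurve Literature.NumberTheory.EllipticCurves
  Literature.NumberTheory.EllipticCurves.Rank1Residual

namespace Literature.NumberTheory.EllipticCurves.BurungaleSkinnerTianWan2024

/-! ### Thm. 10.12 — full BSD for the rank-zero quadratic twists of a semistable curve -/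

/-- **OPEN HYPOTHESIS — UNREFEREED PREPRINT (arXiv:2409.01350v2), Thm. 10.12 (p. 89).** For `E/ℚ`
semistable of conductor `N` and `M > 1` square-free with `(M,N) = 1`, under (i) `L(1,E^{(M)}) ≠ 0`,
(ii) the `2`-part of BSD for `E^{(M)}`, (iii) `a_3(E) = 0`, (iv) `E[p]` absolutely irreducible for all
odd `p`, (v) for every prime `p ∣ N` a multiplicative prime `q ≠ p` at which `E[p]` is ramified, (vi) `E`
ordinary at the primes dividing `M`: BSD is true for `E^{(M)}` (`E^{(M)}(ℚ)`, `Ш(E^{(M)})` finite and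
`L(1,E^{(M)})/Ω = #Ш·∏c_ℓ/#tors²`). Transcribed: `W₀` a globally minimal model of `E`
(`Semistable W₀`), `W` a globally minimal model of `E^{(M)}` (`C • W = W₀.quadraticTwist M`),
`1 < M`, `Squarefree M`, `Nat.Coprime M (W₀.conductorNorm ℤ)`; (i) `W.entireLFunction 1 ≠ 0`;
(ii) `BSDp W 2`; (iii) `W₀.frobeniusTrace 3 = 0`; (iv) `Irr W₀ p` for every odd prime `p`; (v) `Ram W₀ p`
for every prime `p ∣ N`; (vi) `GoodOrd W₀ q` for every prime `q ∣ M`; conclusion `W.BSDTriple`. NEVER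
cite this `Prop` as a theorem (its supersingular input is Cor. 10.2 = `thm15_pPart_OPEN`'s body form).
[claim: BurungaleSkinnerTianWan2024, status: under-review]
[cite: BurungaleSkinnerTianWan2024, Thm. 10.12 (p. 89; label theoretic, tex l.7535; ANNOUNCED, OPEN binder)] -/
def thm1012_fullBSD_rankZeroTwists_OPEN : Prop :=
  ∀ (W₀ W : WeierstrassCurve ℚ) [W₀.IsElliptic] [W₀.IsGloballyMinimal] [W.IsElliptic]
    [W.IsGloballyMinimal] (M : ℕ) (C : VariableChange ℚ),
    Semistable W₀ → 1 < M → Squarefree M → Nat.Coprime M (W₀.conductorNorm ℤ) →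
    C • W = W₀.quadraticTwist (M : ℚ) →
    W.entireLFunction 1 ≠ 0 →
    BSDp W 2 →
    W₀.frobeniusTrace 3 = 0 →
    (∀ p : ℕ, (hp : p.Prime) → p ≠ 2 → (haveI : Fact p.Prime := ⟨hp⟩; Irr W₀ p)) →
    (∀ p : ℕ, (hp : p.Prime) → p ∣ W₀.conductorNorm ℤ → (haveI : Fact p.Prime := ⟨hp⟩; Ram W₀ p)) →
    (∀ q : ℕ, (hq : q.Prime) → q ∣ M → (haveI : Fact q.Prime := ⟨hq⟩; GoodOrd W₀ q)) →
    W.BSDTriple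

/-! ### Thm. 11.12 — the `p`-part of BSD in analytic rank one (elliptic-curve instance) -/

/-- **OPEN HYPOTHESIS — UNREFEREED PREPRINT (arXiv:2409.01350v2), Thm. 11.12 (p. 94), non-CM clauses,
for an elliptic curve** (`A_g = E`, `F = ℚ`, `d = 1`, `λ = p`). "Let `p ∤ 2N` … Suppose that • either
`p ∤ a_p` or `a_p = 0`, • if `p ∤ a_p`, then `ρ` satisfies (irr_ℚ) and (ram); if `a_p = 0`, then `N` is
square-free. If `ord_{s=1} L(s,E) = 1`, then the `p`-part of BSD holds, that is, `rank_ℤ E(ℚ) = 1`,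
`Ш(E)[p^∞]` is finite and `|L'(1,E)/(Ω_E R(E))|_p^{-1} = |#Ш(E)[p^∞]·∏_{ℓ∣N} c_ℓ(E)|_p^{-1}`."
Transcribed for a globally minimal `W`: `p ≠ 2`, good reduction at `p`, and EITHER the ordinary branch
(`p ∤ a_p`, `Irr W p`, `Ram W p`) OR the supersingular branch (`a_p = 0`, `Semistable W`);
`W.analyticRank = 1` ⇒ `W.mordellWeilRank = 1 ∧ Finite Ш[p^∞] ∧` the no-torsion print shape at `p`.
The ordinary branch is Thm. 1.9 (`thm19_of_thm1112_OPEN` below); the supersingular branch is the `r = 1`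
case of Cor. 10.2 / Thm. 1.5. NEVER cite this `Prop` as a theorem.
[claim: BurungaleSkinnerTianWan2024, status: under-review]
[cite: BurungaleSkinnerTianWan2024, Thm. 11.12 (p. 94; label p-BSD, tex l.8031; ANNOUNCED, OPEN binder)] -/
def thm1112_pPart_rankOne_OPEN : Prop :=
  ∀ (W : WeierstrassCurve ℚ) [W.IsElliptic] [W.IsGloballyMinimal] (p : ℕ) [Fact p.Prime],
    p ≠ 2 → W.HasGoodReductionAtPrime p →
    ((¬ (p : ℤ) ∣ W.frobeniusTrace p ∧ Irr W p ∧ Ram W p) ∨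
      (W.frobeniusTrace p = 0 ∧ Semistable W)) →
    W.analyticRank = 1 →
      W.mordellWeilRank = 1 ∧ Finite (AddCommGroup.primaryComponent W.sha p) ∧
      ∃ q : ℚ, W.leadingLCoeff / ((W.realPeriodRat * W.regulator : ℝ) : ℂ) = (q : ℂ) ∧
        padicValRat p q = (padicValNat p W.shaOrder : ℤ) + padicValNat p W.tamagawaProduct

/-- **OPEN HYPOTHESIS — UNREFEREED PREPRINT (arXiv:2409.01350v2), Thm. 11.12 (p. 94), CM clause, for an
elliptic curve.** "In the CM case the same holds for any ordinary or a supersingular prime `p ∤ 2N`"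
(Rem. 11.13 (ii): for CM curves the `p`-part in analytic rank one at `p ∤ 2N` is due to Rubin [Ru1]
(ordinary) and Kobayashi [Ko1] (supersingular); the paper gives another proof). Transcribed: `W` globally
minimal with complex multiplication (`W.HasCM`), `p ≠ 2` good, `p ∤ a_p` or `a_p = 0` (the paper's
"ordinary or supersingular"), `W.analyticRank = 1` ⇒ the same three conclusions. The tree's PUBLISHED
CM statements of this shape live in `Kobayashi2013/CMRankOnePPart.lean` (`cor14_bsdp_of_cm_rank_one`);
this binder records only what BSTW print. NEVER cite this `Prop` as a theorem.
[claim: BurungaleSkinnerTianWan2024, status: under-review]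
[cite: BurungaleSkinnerTianWan2024, Thm. 11.12, last sentence, with Rem. 11.13 (ii) (pp. 94–95; ANNOUNCED, OPEN binder)] -/
def thm1112_cm_pPart_rankOne_OPEN : Prop :=
  ∀ (W : WeierstrassCurve ℚ) [W.IsElliptic] [W.IsGloballyMinimal] (p : ℕ) [Fact p.Prime],
    W.HasCM → p ≠ 2 → W.HasGoodReductionAtPrime p →
    (¬ (p : ℤ) ∣ W.frobeniusTrace p ∨ W.frobeniusTrace p = 0) →
    W.analyticRank = 1 →
      W.mordellWeilRank = 1 ∧ Finite (AddCommGroup.primaryComponent W.sha p) ∧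
      ∃ q : ℚ, W.leadingLCoeff / ((W.realPeriodRat * W.regulator : ℝ) : ℂ) = (q : ℂ) ∧
        padicValRat p q = (padicValNat p W.shaOrder : ℤ) + padicValNat p W.tamagawaProduct

/-- Thm. 1.9 is the ordinary branch of Thm. 11.12 for an elliptic curve ("see Theorem 11.12" after
Thm. 1.9, p. 5): the binder `thm1112_pPart_rankOne_OPEN` implies the binder
`thm19_pPart_rankOne_ordinary_OPEN`. Bookkeeping between OPEN binders; asserts nothing.
[claim: BurungaleSkinnerTianWan2024, status: under-review]
[cite: BurungaleSkinnerTianWan2024, Thm. 1.9 (p. 5) and Thm. 11.12 (p. 94)] -/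
theorem thm19_of_thm1112_OPEN (h : thm1112_pPart_rankOne_OPEN) :
    thm19_pPart_rankOne_ordinary_OPEN := by
  intro W _ _ p _ hp hord hirr hram h1
  exact (h W p hp hord.1 (Or.inl ⟨hord.2, hirr, hram⟩) h1).2.2

/-- **Bridge for Thm. 11.12 (CONDITIONAL).** IF the announced Thm. 11.12 (`hBSTW_OPEN`, unrefereed)
holds, then at every pair `(E, p)` in either branch with `E[p]` irreducible and analytic rank `1`,
Miller's `BSD(E,p)` follows via `bsdp_of_padicVal_printShape` (Gross–Zagier–Kolyvagin `hGZK` by name).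
In the supersingular branch at odd `p` the irreducibility is Serre's (tree theorem
`Rank1Residual.ClassX6.irr` on class X6); it is kept as the binder `hirr` here. Closes nothing.
[claim: BurungaleSkinnerTianWan2024, status: under-review] [cite: Miller2011LMS, §1 and Def. 1.1] -/
theorem bsdp_of_thm1112_OPEN (hBSTW_OPEN : thm1112_pPart_rankOne_OPEN)
    (hGZK : rank_eq_analyticRank_of_analyticRank_le_one)
    (W : WeierstrassCurve ℚ) [W.IsElliptic] [W.IsGloballyMinimal] (p : ℕ) [Fact p.Prime]
    (hp : p ≠ 2) (hgood : W.HasGoodReductionAtPrime p)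
    (hbr : (¬ (p : ℤ) ∣ W.frobeniusTrace p ∧ Irr W p ∧ Ram W p) ∨
      (W.frobeniusTrace p = 0 ∧ Semistable W))
    (hirr : Irr W p) (h1 : W.analyticRank = 1) : BSDp W p :=
  bsdp_of_padicVal_printShape W p hGZK h1.le hirr (hBSTW_OPEN W p hp hgood hbr h1).2.2

/-! ### Thm. 12.3 — `p`-converse I (corank one with finite `Ш[p^∞]`), elliptic-curve instance -/

/-- **OPEN HYPOTHESIS — UNREFEREED PREPRINT (arXiv:2409.01350v2), Thm. 12.3 (p. 96), for an elliptic
curve** (`A_g = E`, `F = ℚ`, `λ = p`). "Let `p ∤ 2N` … Suppose the following: • Either `a_p = 0` and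
`N` is square-free or `p ∤ a_p`, • `ρ` satisfies (irr_ℚ) if `E` is non-CM, and (ram) holds if `p = 3`.
Then `corank_{ℤ_p} Sel_{p^∞}(E) = 1, #Ш(E)[p^∞] < ∞ ⟹ ord_{s=1} L(s,E) = 1`." Transcribed for a
globally minimal `W`: `p ≠ 2` good; (`a_p = 0 ∧ Semistable W`) ∨ `p ∤ a_p`; `¬ W.HasCM → Irr W p`;
`p = 3 → Ram W p`; `W.selmerCorank p = 1`; `Finite Ш[p^∞]` ⇒ `W.analyticRank = 1`. Compare the tree's
Thm. 1.10 binder (`burungaleSkinnerTianWan_analyticRank_eq_one_of_selmerCorank_eq_one`: ordinary only,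
(sur_ℚ) + (ram), NO finiteness of `Ш[p^∞]`) — Thm. 12.3 trades the finiteness hypothesis for weaker
image/ramification hypotheses and covers the supersingular semistable case (Rem. 12.4 (i): "for `N`
square-free and `p` ordinary [this] goes back to [Sk']"). NEVER cite this `Prop` as a theorem.
[claim: BurungaleSkinnerTianWan2024, status: under-review]
[cite: BurungaleSkinnerTianWan2024, Thm. 12.3 (p. 96; label p-converse, tex l.8146; ANNOUNCED, OPEN binder)] -/
def thm123_pConverse_rankOne_OPEN : Prop :=
  ∀ (W : WeierstrassCurve ℚ) [W.IsElliptic] [W.IsGloballyMinimal] (p : ℕ) [Fact p.Prime],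
    p ≠ 2 → W.HasGoodReductionAtPrime p →
    ((W.frobeniusTrace p = 0 ∧ Semistable W) ∨ ¬ (p : ℤ) ∣ W.frobeniusTrace p) →
    (¬ W.HasCM → Irr W p) → (p = 3 → Ram W p) →
    W.selmerCorank p = 1 → Finite (AddCommGroup.primaryComponent W.sha p) →
      W.analyticRank = 1

/-! ### Cor. 12.5 — rank `r ≤ 1` with finite `Ш` forces analytic rank `r` (elliptic-curve instance) -/

/-- **OPEN HYPOTHESIS — UNREFEREED PREPRINT (arXiv:2409.01350v2), Cor. 12.5 (p. 96), for an elliptic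
curve** (`A_g = E`, `F = ℚ`). "For `r ∈ {0,1}`, `rank_ℤ E(ℚ) = r, #Ш(E) < ∞ ⟹ ord_{s=1} L(s,E) = r`"
— the implication (1) ⟹ (3) of the paper's Conj. 1.1 (BSD in ranks `0` and `1`), with NO hypothesis on
the curve or on a prime (the proof picks an auxiliary good ordinary `p ∤ 2N` with (irr_ℚ), which exists
for non-CM `E` by Serre; the CM case is credited to [Ru1, BuTi]; Rem. 12.6: "independently obtained by
Kim [Ki1]"). Transcribed for a globally minimal `W`: `W.mordellWeilRank ≤ 1 → W.ShaFinite →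
W.BSDRankFormula` (`BSDRankFormula W : r_an = rank`). The tree's PUBLISHED statements of this shape carry
extra hypotheses: `skinner_analyticRank_eq_one_of_mordellWeilRank_eq_one` (Skinner 2020 Thm. A′:
semistable + a multiplicative-prime condition, `r = 1`), `kim_analyticRank_eq_one_of_mordellWeilRank_eq_one`
(Kim 2022 Cor. 1.4: a good ordinary `p > 3` with `E[p]` irreducible). NEVER cite this `Prop` as a theorem.
[claim: BurungaleSkinnerTianWan2024, status: under-review]
[cite: BurungaleSkinnerTianWan2024, Cor. 12.5 (p. 96; label pcv-w, tex l.8189; ANNOUNCED, OPEN binder)] -/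
def cor125_bsdRankFormula_of_rank_le_one_of_shaFinite_OPEN : Prop :=
  ∀ (W : WeierstrassCurve ℚ) [W.IsElliptic] [W.IsGloballyMinimal],
    W.mordellWeilRank ≤ 1 → W.ShaFinite → W.BSDRankFormula

/-- Reading Cor. 12.5 against Conj. 1.1: granted the OPEN binder, for a curve of Mordell–Weil rank
`r ≤ 1` with finite `Ш` the three numbers `rank_ℤ E(ℚ)`, `corank_{ℤ_p} Sel_{p^∞}(E/ℚ)` (any `p`) and
`ord_{s=1} L(E,s)` coincide — (1) ⟹ (2) is the exact sequence (1.1) [`selmerCorank = rank + corank Ш[p^∞]`,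
the tree's PROVED `selmerCorank_eq_holds`, and a finite group has corank `0`], (1) ⟹ (3) is the binder.
Bookkeeping; closes nothing. [claim: BurungaleSkinnerTianWan2024, status: under-review]
[cite: BurungaleSkinnerTianWan2024, Conj. 1.1 and Cor. 12.5 (pp. 2, 96)] [cite: Greenberg1999] -/
theorem analyticRank_eq_and_selmerCorank_eq_of_cor125_OPEN
    (h : cor125_bsdRankFormula_of_rank_le_one_of_shaFinite_OPEN)
    (W : WeierstrassCurve ℚ) [W.IsElliptic] [W.IsGloballyMinimal]
    (hr : W.mordellWeilRank ≤ 1) (hfin : W.ShaFinite) (p : ℕ) [Fact p.Prime] :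
    W.analyticRank = W.mordellWeilRank ∧ W.selmerCorank p = W.mordellWeilRank := by
  refine ⟨h W hr hfin, ?_⟩
  rw [selmerCorank_eq_holds W p]
  haveI : Finite W.sha := hfin
  haveI : Finite (AddCommGroup.primaryComponent W.sha p) :=
    Finite.of_injective _ Subtype.val_injective
  simp [WeierstrassCurve.shaCorank, zpCorank_of_finite_eq_zero]

end Literature.NumberTheory.EllipticCurves.BurungaleSkinnerTianWan2024

end
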